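/-
Copyright (c) 2026. All rights reserved.
Released under Apache 2.0 license as described in the file LICENSE.
-/
import Summits.HodgeConjecture.HodgeConjecture.Theorems.K2LiuStdArchCompactConjugate   -- ★ B2 `exists_conj_archCompact`
import Summits.HodgeConjecture.HodgeConjecture.Theorems.K2LiuHermitianTubeFrameSign      -- ★ arch₄, ★ `frameInv_kappa_frame`
import Summits.HodgeConjecture.HodgeConjecture.Theorems.K2LiuArchFrameBridge             -- ★ `exists_kappa_eq_of_stab`
import HarnessLib

/-!
# Crux `HLiu418`, G6-arch ASSEMBLY FILE 21 — (E8rec) THE FRAME-COMPACT CONJUGATOR: for a STANDARD Iwasawa datum, some `g ∈ H_∞` conjugates the tube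
# frame's compact `K_fr = {k : T_w k_w T_w⁻¹ ∈ Stab(i·1) ∀ w}` into the datum's archimedean compact — the letter `hconj` of ★ FILE 20 `archFace_of_conjugator`

Cell `hodgecm-mathlib`, crux item hLiu418 = `stmt-HodgeConjecture-24832` (helper lane `--supports`, count-neutral).  K2Liu-p11 (g4).
* **`exists_frameCompact_conjugator`** — for the EXPLICIT Shimura frame `(T_w, T_w⁻¹)` of ★ `exists_tubeFrame_arch₄` (x): `∃ g, ∀ k, (∀ w, moeb (T_w k_w T_w⁻¹) (i1) = i1) →
  (g k g⁻¹, 1) ∈ 𝒦.K`.  Road: ★ B2 `exists_conj_archCompact` (`(a,1) ∈ 𝒦.K ↔ SignBlock(g⁻¹ a g)`) at `a := g k g⁻¹`; `T_w k_w T_w⁻¹ ∈ U(J) ∩ Stab(i1)` is `κ(k₁,k₂)`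
  (★ arch₄ (iii), ★ `exists_kappa_eq_of_stab`), so `k_w = T_w⁻¹ κ(k₁,k₂) T_w` is SIGN-SORTED (★ `frameInv_kappa_frame`): its `(i,j)` entry vanishes whenever the real diagonal
  entries `σ_w(J^𝔻_ii)`, `σ_w(J^𝔻_jj)` (★ `hermD_map_embedding`: `t_w ⊕ −t_w` in the enumeration `e₂`) have opposite signs — the SignBlock condition.
References: [Shimura1997, §§5–6, §6.5]; [BorelJacquet1979, §4.1]; [KonnoKonno2007, §3.1].
HONEST LABEL: HC_CM is proved only modulo the 7 printed citations (2 remaining named inputs: hLiu418 = stmt-HodgeConjecture-24832,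
h413 = stmt-HodgeConjecture-24833) until rung 0 closes; count-neutral helper, closes no socket.
-/

set_option autoImplicit false
set_option linter.dupNamespace false

noncomputable section

open scoped Matrix ComplexConjugate
open Complex Matrix NumberField NumberField.InfinitePlace
open Literature.NumberTheory.ModularForms.SiegelUpperHalfSpace (moeb)
open Literature.NumberTheory.Automorphic Literature.NumberTheory.Automorphic.UnitaryGroup
open Literature.NumberTheory.GelbartRogawski1991 Literature.NumberTheory.GelbartRogawski1991.GRConstruction
open Literature.NumberTheory.GelbartRogawski1991.UnitaryDualPair
open Literature.NumberTheory.K2Lit.SiegelDoubled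

namespace Summit.HodgeConjecture.HodgeConjecture.Cruxes.HLiu418.K2LiuArchFrameCompactConjugator

open K2LiuArchInducedTubeDefs K2LiuSiegelUnipotentLocalDefs
open K2LiuStdArchCompactConjugate (exists_conj_archCompact)
open K2LiuHermitianTubeFrameSign (exists_tubeFrame_arch₄ frameInv_kappa_frame)
open K2LiuHermitianTubeFrameArch (tw_ne_zero hermD_map_embedding)
open K2LiuArchFrameBridge (exists_kappa_eq_of_stab)

variable (L : Type) [Field L] [NumberField L] [IsCMField L] {N M n : ℕ} (e : Fin N × Fin M ≃ Fin n)
  (dV : Fin N → L) (hdV : ∀ i, IsCMField.complexConj L (dV i) = dV i) (hdV0 : ∀ i, dV i ≠ 0)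
  (dW : Fin M → L) (hdW : ∀ i, IsCMField.complexConj L (dW i) = dW i) (hdW0 : ∀ i, dW i ≠ 0)

/-- an entry of `X` read in the block enumeration `e₂`. [folklore] -/
theorem apply_eq_reindex_symm_apply (X : Matrix (Fin (n + n)) (Fin (n + n)) ℂ) (i j : Fin (n + n)) :
    X i j = Matrix.reindex (e₂ (n := n)).symm (e₂ (n := n)).symm X ((e₂ (n := n)).symm i) ((e₂ (n := n)).symm j) := by
  simp only [Matrix.reindex_apply, Equiv.symm_symm, Matrix.submatrix_apply, Equiv.apply_symm_apply]

/-- the sign-sorted entry vanishes off the sign pattern: `t a · t b < 0 ⇒ (if 0 < t a then (if 0 < t b then x else 0) else (if 0 < t b then 0 else y)) = 0`. [folklore] -/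
theorem ite_sorted_eq_zero_of_mul_neg {ta tb : ℝ} (h : ta * tb < 0) (x y : ℂ) :
    (if 0 < ta then (if 0 < tb then x else 0) else (if 0 < tb then 0 else y)) = 0 := by
  by_cases hta : 0 < ta
  · have htb : ¬ 0 < tb := fun htb => absurd h (not_lt.2 (mul_pos hta htb).le)
    rw [if_pos hta, if_neg htb]
  · have hta' : ta < 0 := lt_of_le_of_ne (not_lt.1 hta) fun h0 => by rw [h0, zero_mul] at h; exact lt_irrefl _ h
    have htb : 0 < tb := by
      by_contra htb
      exact absurd h (not_lt.2 (mul_nonneg_of_nonpos_of_nonpos hta'.le (not_lt.1 htb)))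
    rw [if_neg hta, if_pos htb]

/-- the complementary pattern: `0 < t a · t b ⇒ (if 0 < t a then (if 0 < t b then 0 else x) else (if 0 < t b then y else 0)) = 0`. [folklore] -/
theorem ite_sorted_eq_zero_of_mul_pos {ta tb : ℝ} (h : 0 < ta * tb) (x y : ℂ) :
    (if 0 < ta then (if 0 < tb then 0 else x) else (if 0 < tb then y else 0)) = 0 := by
  by_cases hta : 0 < ta
  · have htb : 0 < tb := pos_of_mul_pos_right h hta.le
    rw [if_pos hta, if_pos htb]
  · have htb : ¬ 0 < tb := fun htb => hta (pos_of_mul_pos_left h htb.le)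
    rw [if_neg hta, if_neg htb]

include hdV0 hdW0 in
/-- **THE FRAME-COMPACT CONJUGATOR** (see the module docstring): the letter `hconj` of ★ `K2LiuArchFaceOfRecord.archFace_of_conjugator`, for every standard datum.
[Shimura1997, §6.5] [BorelJacquet1979, §4.1] [KonnoKonno2007, §3.1] -/
theorem exists_frameCompact_conjugator {𝒦 : IwasawaDatum L e dV hdV dW hdW} (h𝒦 : 𝒦.IsStd)
    (T Tinv : {w : InfinitePlace L // w.IsComplex} → Matrix (Fin n ⊕ Fin n) (Fin n ⊕ Fin n) ℂ)
    (hTdef : ∀ w, T w = fromBlocks (diagonal (fun k => (Real.sqrt (|(w.1.embedding (dV (e.symm k).1 * dW (e.symm k).2)).re| / 2) : ℂ))) (diagonal (fun k => (Real.sqrt (|(w.1.embedding (dV (e.symm k).1 * dW (e.symm k).2)).re| / 2) : ℂ)))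
          (diagonal (fun k => I * ((((w.1.embedding (dV (e.symm k).1 * dW (e.symm k).2)).re / |(w.1.embedding (dV (e.symm k).1 * dW (e.symm k).2)).re|) * Real.sqrt (|(w.1.embedding (dV (e.symm k).1 * dW (e.symm k).2)).re| / 2) : ℝ) : ℂ))) (-diagonal (fun k => I * ((((w.1.embedding (dV (e.symm k).1 * dW (e.symm k).2)).re / |(w.1.embedding (dV (e.symm k).1 * dW (e.symm k).2)).re|) * Real.sqrt (|(w.1.embedding (dV (e.symm k).1 * dW (e.symm k).2)).re| / 2) : ℝ) : ℂ))))
    (hTinvdef : ∀ w, Tinv w = fromBlocks (diagonal (fun k => (((Real.sqrt (|(w.1.embedding (dV (e.symm k).1 * dW (e.symm k).2)).re| / 2))⁻¹ / 2 : ℝ) : ℂ))) (-diagonal (fun k => I * (((Real.sqrt (|(w.1.embedding (dV (e.symm k).1 * dW (e.symm k).2)).re| / 2))⁻¹ * ((w.1.embedding (dV (e.symm k).1 * dW (e.symm k).2)).re / |(w.1.embedding (dV (e.symm k).1 * dW (e.symm k).2)).re|) / 2 : ℝ) : ℂ)))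
          (diagonal (fun k => (((Real.sqrt (|(w.1.embedding (dV (e.symm k).1 * dW (e.symm k).2)).re| / 2))⁻¹ / 2 : ℝ) : ℂ))) (diagonal (fun k => I * (((Real.sqrt (|(w.1.embedding (dV (e.symm k).1 * dW (e.symm k).2)).re| / 2))⁻¹ * ((w.1.embedding (dV (e.symm k).1 * dW (e.symm k).2)).re / |(w.1.embedding (dV (e.symm k).1 * dW (e.symm k).2)).re|) / 2 : ℝ) : ℂ)))) :
    ∃ g : UnitaryGroup.arch (Fp L) L (IsCMField.complexConj L) (n + n) (hermD L e dV hdV dW hdW), ∀ k : UnitaryGroup.arch (Fp L) L (IsCMField.complexConj L) (n + n) (hermD L e dV hdV dW hdW),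
      (∀ w, moeb (T w * Matrix.reindex (e₂ (n := n)).symm (e₂ (n := n)).symm (((UnitaryGroup.archAt (Fp L) L (IsCMField.complexConj L) (n + n) (hermD L e dV hdV dW hdW) w (UnitaryGroup.complexConj_smul_infinitePlace L w.1) (IsCMField.complexConj_ne_one L) k : UnitaryGroup.archLocal L (n + n) (hermD L e dV hdV dW hdW) w) : GL (Fin (n + n)) ℂ) : Matrix (Fin (n + n)) (Fin (n + n)) ℂ) * Tinv w)
        (I • (1 : Matrix (Fin n) (Fin n) ℂ)) = I • 1) →
      (UnitaryGroup.archToAdelic (Fp L) L (IsCMField.complexConj L) (n + n) (hermD L e dV hdV dW hdW) (g * k * g⁻¹) : HA L e dV hdV dW hdW) ∈ 𝒦.K := by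
  obtain ⟨g, hg⟩ := exists_conj_archCompact L e dV hdV hdV0 dW hdW hdW0 h𝒦
  refine ⟨g, fun k hk => (hg _).2 fun w i j hij => ?_⟩
  rw [show g⁻¹ * (g * k * g⁻¹) * g = k by group]
  have hw : IsCMField.complexConj L • w.1 = w.1 := UnitaryGroup.complexConj_smul_infinitePlace L w.1
  have ht : ∀ a : Fin n, (w.1.embedding (dV (e.symm a).1 * dW (e.symm a).2)).re ≠ 0 := tw_ne_zero L e dV hdV dW hdW w hw hdV0 hdW0
  -- the place component and its block reading
  obtain ⟨X, hX⟩ : ∃ X : Matrix (Fin (n + n)) (Fin (n + n)) ℂ, X = (((UnitaryGroup.archAt (Fp L) L (IsCMField.complexConj L) (n + n) (hermD L e dV hdV dW hdW) w (UnitaryGroup.complexConj_smul_infinitePlace L w.1) (IsCMField.complexConj_ne_one L) k : UnitaryGroup.archLocal L (n + n) (hermD L e dV hdV dW hdW) w) : GL (Fin (n + n)) ℂ) : Matrix (Fin (n + n)) (Fin (n + n)) ℂ) := ⟨_, rfl⟩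
  obtain ⟨u, hu⟩ : ∃ u : Matrix (Fin n ⊕ Fin n) (Fin n ⊕ Fin n) ℂ, u = T w * Matrix.reindex (e₂ (n := n)).symm (e₂ (n := n)).symm X * Tinv w := ⟨_, rfl⟩
  -- `u ∈ U(J) ∩ Stab(i1)` is `κ(k₁,k₂)` (★ arch₄ (iii) for the explicit frame, ★ `exists_kappa_eq_of_stab`)
  obtain ⟨T', Tinv', h1', h2', hTU', -, -, -, -, -, hT'def, hTinv'def⟩ := exists_tubeFrame_arch₄ L e dV hdV dW hdW w hw hdV0 hdW0
  have hT' : T' = T w := hT'def.trans (hTdef w).symm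
  have hTinv' : Tinv' = Tinv w := hTinv'def.trans (hTinvdef w).symm
  rw [hT', hTinv'] at hTU' h2'
  have hUu : uᴴ * Matrix.J (Fin n) ℂ * u = Matrix.J (Fin n) ℂ := by
    rw [hu, hX]
    exact hTU' _ (UnitaryGroup.archAt (Fp L) L (IsCMField.complexConj L) (n + n) (hermD L e dV hdV dW hdW) w
      (UnitaryGroup.complexConj_smul_infinitePlace L w.1) (IsCMField.complexConj_ne_one L) k).2
  have hIu : moeb u (I • (1 : Matrix (Fin n) (Fin n) ℂ)) = I • 1 := by rw [hu, hX]; exact hk w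
  obtain ⟨-, -, hκ⟩ := exists_kappa_eq_of_stab hUu hIu
  obtain ⟨k₁, k₂, hκ'⟩ : ∃ k₁ k₂ : Matrix (Fin n) (Fin n) ℂ, u = (fromBlocks 1 1 (I • 1) (-(I • 1)) : Matrix (Fin n ⊕ Fin n) (Fin n ⊕ Fin n) ℂ) *
      fromBlocks k₁ 0 0 k₂ * ((2 : ℂ)⁻¹ • fromBlocks 1 (-(I • 1)) 1 (I • 1)) := ⟨_, _, hκ⟩
  -- `X` in the block enumeration is the SIGN-SORTED `T_w⁻¹ κ(k₁,k₂) T_w` (★ `frameInv_kappa_frame`)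
  have hR : Matrix.reindex (e₂ (n := n)).symm (e₂ (n := n)).symm X = Tinv w * u * T w := by
    rw [hu, ← Matrix.mul_assoc, ← Matrix.mul_assoc, h2', Matrix.one_mul, Matrix.mul_assoc, h2', Matrix.mul_one]
  have hfk := frameInv_kappa_frame (fun a : Fin n => (w.1.embedding (dV (e.symm a).1 * dW (e.symm a).2)).re) ht k₁ k₂
  beta_reduce at hfk
  rw [hκ', hTinvdef w, hTdef w, hfk] at hR
  -- the real diagonal entries `σ_w(J^𝔻_ii)` in the enumeration `e₂`
  have hH : ∀ i : Fin (n + n), w.1.embedding (hermD L e dV hdV dW hdW i i) =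
      (Matrix.reindex (e₂ (n := n)) (e₂ (n := n)) (fromBlocks
        (diagonal fun a => ((((w.1.embedding (dV (e.symm a).1 * dW (e.symm a).2)).re) : ℝ) : ℂ)) 0 0
        (-diagonal fun a => ((((w.1.embedding (dV (e.symm a).1 * dW (e.symm a).2)).re) : ℝ) : ℂ)))) i i := fun i => by
    rw [← hermD_map_embedding L e dV hdV dW hdW w hw]; rfl
  -- read the entry (`archPiEquivCM k w = archAt w k` definitionally)
  suffices key : X i j = 0 by rw [hX] at key; exact key
  rw [apply_eq_reindex_symm_apply X i j, hR]
  rw [hH i, hH j] at hij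
  simp only [Matrix.reindex_apply, Matrix.submatrix_apply] at hij
  generalize (e₂ (n := n)).symm i = ii at hij ⊢
  generalize (e₂ (n := n)).symm j = jj at hij ⊢
  rcases ii with a | a <;> rcases jj with b | b
  · simp only [fromBlocks_apply₁₁, diagonal_apply_eq, Complex.ofReal_re] at hij
    rw [fromBlocks_apply₁₁, Matrix.of_apply, ite_sorted_eq_zero_of_mul_neg hij, mul_zero]
  · simp only [fromBlocks_apply₁₁, fromBlocks_apply₂₂, diagonal_apply_eq, Matrix.neg_apply, Complex.neg_re, Complex.ofReal_re, mul_neg,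
      neg_lt_zero] at hij
    rw [fromBlocks_apply₁₂, Matrix.of_apply, ite_sorted_eq_zero_of_mul_pos hij, mul_zero]
  · simp only [fromBlocks_apply₁₁, fromBlocks_apply₂₂, diagonal_apply_eq, Matrix.neg_apply, Complex.neg_re, Complex.ofReal_re, neg_mul,
      neg_lt_zero] at hij
    rw [fromBlocks_apply₂₁, Matrix.of_apply, ite_sorted_eq_zero_of_mul_pos hij, mul_zero]
  · simp only [fromBlocks_apply₂₂, diagonal_apply_eq, Matrix.neg_apply, Complex.neg_re, Complex.ofReal_re, neg_mul_neg] at hij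
    rw [fromBlocks_apply₂₂, Matrix.of_apply, ite_sorted_eq_zero_of_mul_neg hij, mul_zero]

end Summit.HodgeConjecture.HodgeConjecture.Cruxes.HLiu418.K2LiuArchFrameCompactConjugator

end
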